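/-
Origin: expansion seat `planner-pub-hodgecm-mc-axioms-1-g14-0`, handover #W180 2026-08-20T15:53:55Z md5 c494660811fb (PKG 4384712d1fbb → c494660811fb; 203 l.; MECHANICAL (iib-R) rewrite v3.1 of the PKG file as it stands (64 token edits; rules R1x1+RX[h₂']x63)) (`HOME/mc/pub-hodgecm-mc-axioms-1-g14/revendor/kit-r55/stage55/HodgeCM/Model/Sanity/DegenerateClosure.lean`, md5 c494660811fb, 203 lines);
landed by the gen-22 packager (p-g22) in gate run 55 REPLACES the earlier landed copy of `HodgeCM/Model/Sanity/DegenerateClosure.lean` (seat copy carried the packager Origin header of an earlier run (stripped)).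
-/
/-
Origin: SANITY lane `planner-pub-hodgecm-mc-sanity-1-g5-0` (unit pub-hodgecm-mc-sanity-1-g5, gen 5 of mc-sanity-1,
node SAN-15), 2026-08-19.  v2 («level-free ιinf» JOINT CUT, RUN-35 packet member M13) REPLACEMENT of the RUN-34 cut-B module
`HodgeCM/Model/Sanity/DegenerateClosure.lean` (v1 68a4d704dad7, installed 3425e902bca3): the `hι` bullets of both `refine`s and
the `hRat` bullet of the R13 one are DELETED (binder `hι` gone from E R10″/R13″, glue-1 #316/#320; `hRat` relocated into the pin
data `S.hRat` and supplied inside `degS″` by `Sanity/ThetaAdelicSideDegenerate″` M3); statements byte-identical to v1.  Imports the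
packet members `HodgeCM.Model.E2InstanceR13` (M11, R13″), `HodgeCM.Model.Sanity.ArchKTypeSanity` (M4) and
`HodgeCM.Model.Sanity.ZeroSchwartzIndex` (M12); imported by `Sanity/DegenerateClosureEmpty` (SAN-15b, recompiles unchanged).
Install with the packet only (atomic), in the custodian's slot (after M11 and M12).
KERNEL: 0 records, 0 `Prop` definitions, 0 hypotheses minted, nothing cited, no instances.
Expected `#print axioms`: ⊆ {propext, Classical.choice, Quot.sound}.
-/
import Summits.HodgeConjecture.HodgeCM.Model.E2InstanceR13
import Summits.HodgeConjecture.HodgeCM.Model.Sanity.ArchKTypeSanity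
import Summits.HodgeConjecture.HodgeCM.Model.Sanity.ZeroSchwartzIndex

/-!
# SAN-15 — the DEGENERATE CLOSURE of E R10: one kernel theorem whose hypothesis list IS the census

MODEL-CONSTRUCTION sub-cell, SANITY lane (unit `pub-hodgecm-mc-sanity-1-g5`, node SAN-15).  KERNEL only.

SAN-9 … SAN-12 profiled the binders of E (`Model.perL_picardCM_r10core`, glue-1-g4, RUN 33 of record) ONE AT A TIME
over the two degenerate inhabitants every data slot carries inside itself: the archimedean-trivial theta side
`degS` (SAN-10a `Sanity/ThetaAdelicSideDegenerate`: `Φ∞ :=` a bump, `ι∞ := 1`) and the zero Schwartz index space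
`WmInput.zeroSK W := { W with SK := {0} }` (SAN-12).  This file FEEDS THEM TO E AT ONCE and lets the kernel compute
what is left:

* `perL_r10core_degS` — E R10 at `S := degS`, `W := zeroSK ∘ W` closes `(picardCMUniverse …).PerL` from the
  published / printed inputs `hHR h hA h31`, the data `W μ`, the geometric binder `hBetti` (discharged honestly by
  mc-period-1-g4 at R14, not by toys) and ONE remaining binder: R10's S-side DATA binder `C` read at `degS`
  (`CdegS`).  Every other binder of R10 is supplied by a kernel theorem of this lane with no hypothesis:
  `hLiu` (SAN-11 `hLiu_degS`), `transl` (SAN-11 `transl_degS`), `hol` (SAN-12 `hol_degS`: every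
  restricted theta form over `degS` is `0`), `gen12` (SAN-12 `gen12_degS'`), `real34` / `hyp12` / `hyp34`
  (SAN-12 `real34_zeroSK` / `hyp12_zeroSK` / `hyp34_zeroSK`).
* `perL_r13core_degS` — the same for E R13″ (`hRat` now a pin field, free inside `degS″`).
* `CdegS` is NOT inhabitable against any honest context: SAN-10b `isEmpty_C_fibre_degS` (no `ArchKTypeData` over
  `degS` at `N ≠ 0`: the highest-weight vector would have to be a non-zero multiple of a theta form that is `0`).
  Hence `CdegS` is EQUIVALENT to the VACUITY RESIDUAL `NoGoodSextic` — "the sign recipe of E's model admits no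
  anisotropic good seesaw context of degree 6" (`nonempty_CdegS_iff_noGoodSextic`) — and E R10 closes from toys exactly
  modulo that residual (`perL_r10core_of_noGoodSextic`).

READING (census, MODEL-N ±0; nothing here is a defect claim).  (i) The kernel confirms the lane's census in one
line: over degenerate data EVERY binder of E R10 except `C` is free, and `C` is the gatekeeper — it rejects `degS` at
the first honest context.  (ii) The price of closing E with toys is precisely the vacuity of PerL's hypothesis class
for E's sign recipe; the package contains (to this lane's knowledge, RUN 33) no kernel witness of a good sextic
context, so `NoGoodSextic` is neither provable nor refutable inside PKG today — it is the exact boundary between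
"E is closed" and "E is closed about something".  A kernel inhabitant of `GoodCtx` at one honest `(L, ι₁, V, c)` with
`finrank ℚ c.K = 6` and `V.Hm` anisotropic (an EXAMPLE context, e.g. from the printed source's own examples) would
turn (ii) into `IsEmpty CdegS` (`isEmpty_CdegS_of_goodSextic`), i.e. a kernel certificate that the toy closure is impossible; whether
that example is worth a node is the carvers' call, not this lane's.
-/

set_option autoImplicit false

noncomputable section

namespace HodgeCM
namespace Model
namespace Sanity

open HodgeCM.Universe (SideData ThetaModel AdelicThetaCore AdelicTorusCore)
open HodgeCM.PerL34 HodgeCM.PerL34.ArchC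
open Literature.AlgebraicGeometry.HodgeTheory Literature.NumberTheory.Automorphic.PicardCM
open Literature.NumberTheory.Transcendental (Arapura2012_Cor_15_4_6)
open Literature.AlgebraicGeometry.ShimuraVarieties
open HodgeCM.Model.ThetaSpace

variable (hHD : exists_isReal_hodgeModel) (hI : hodgePQ_independent_of_hodgeModel)
  (h₁ : BallQuotientUniformised)  (h₃ : CMAbelianVarietyRealised)

/-- R10's S-side DATA binder `C` (a TYPE: `ArchKTypeData` is a structure) read at the degenerate inhabitants
`S := degS`, `W := zeroSK ∘ W` — verbatim shape of `Model.perL_picardCM_r10core`'s binder. -/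
abbrev CdegS (h : Bool) (hA : Arapura2012_Cor_15_4_6)
    (W : ∀ {L : CMField} {ι₁ : L →+* ℂ} (V : HermSpace3 L ι₁) (c : SeesawCtx L), WmInput V c.D)
    (μ : ∀ {L : CMField}, SeesawCtx L → Fin 4 → NumberField.InfinitePlace L → ℤ) : Type 1 :=
  ∀ {L : CMField} {ι₁ : L →+* ℂ} (V : HermSpace3 L ι₁) (c : SeesawCtx L) (hV : IsAnisotropic L V.Hm),
    (thetaModelOf hHD hI h₁ h₃ h (embOf hHD hI h₁ h₃) (coverOf hHD hI h₁ h₃ hA)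
      (wmOfInput fun V c => (W V c).zeroSK)
      (thetaOf _ (thetaClassInputOf _ (fun V c => thetaSpaceInputOf hHD hI h₁ h₃ degS V c))) (d12Of μ)
      (d34Of μ)).GoodCtx ι₁ c →
    Module.finrank ℚ c.K = 6 → ∀ k : Fin 4, k = 0 ∨ k = 1 → ∀ N : ℕ, 0 < N →
      ArchKTypeData (thetaSpaceInputIn hHD hI h₁ h₃ (degS V c) hV) k N

/-- The VACUITY RESIDUAL: E's model over the degenerate data admits no anisotropic good seesaw context of degree 6. -/
abbrev NoGoodSextic (h : Bool) (hA : Arapura2012_Cor_15_4_6)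
    (W : ∀ {L : CMField} {ι₁ : L →+* ℂ} (V : HermSpace3 L ι₁) (c : SeesawCtx L), WmInput V c.D)
    (μ : ∀ {L : CMField}, SeesawCtx L → Fin 4 → NumberField.InfinitePlace L → ℤ) : Prop :=
  ∀ {L : CMField} {ι₁ : L →+* ℂ} (V : HermSpace3 L ι₁) (c : SeesawCtx L), IsAnisotropic L V.Hm →
    (thetaModelOf hHD hI h₁ h₃ h (embOf hHD hI h₁ h₃) (coverOf hHD hI h₁ h₃ hA)
      (wmOfInput fun V c => (W V c).zeroSK)
      (thetaOf _ (thetaClassInputOf _ (fun V c => thetaSpaceInputOf hHD hI h₁ h₃ degS V c))) (d12Of μ)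
      (d34Of μ)).GoodCtx ι₁ c →
    Module.finrank ℚ c.K ≠ 6

/-- **E R10 over the degenerate data closes PerL modulo the single binder `C`** — every other binder of
`Model.perL_picardCM_r10core` at `S := degS`, `W := zeroSK ∘ W` is a hypothesis-free kernel theorem of this lane. -/
theorem perL_r10core_degS (hHR : BettiUniverse.HodgeRiemann20) (h : Bool) (hA : Arapura2012_Cor_15_4_6)
    (W : ∀ {L : CMField} {ι₁ : L →+* ℂ} (V : HermSpace3 L ι₁) (c : SeesawCtx L), WmInput V c.D)
    (μ : ∀ {L : CMField}, SeesawCtx L → Fin 4 → NumberField.InfinitePlace L → ℤ)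
    (hBetti : ∀ {L : CMField} {ι₁ : L →+* ℂ} (V : HermSpace3 L ι₁), EmbBettiSide hHD hI h₁ h₃ V)
    (h31 : (picardCMUniverse hHD hI h₁ h₃).Fact_cmInflation)
    (C : CdegS hHD hI h₁ h₃ h hA W μ) :
    (picardCMUniverse hHD hI h₁ h₃).PerL := by
  refine perL_picardCM_r10core hHD hI h₁ h₃ hHR h hA (fun V c => (W V c).zeroSK) degS μ hBetti h31
    ?_ ?_ C ?_ ?_ ?_ ?_ ?_
  · -- `hLiu` — SAN-11 `hLiu_degS`
    intro L ι₁ V c hc hK i Γ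
    exact hLiu_degS hHD hI h₁ h₃ h (embOf hHD hI h₁ h₃) (coverOf hHD hI h₁ h₃ hA)
      (wmOfInput fun V c => (W V c).zeroSK) (d12Of μ) (d34Of μ) V c hc hK i Γ
  · -- `transl` — SAN-11 `transl_degS`
    intro L ι₁ V c hc hK
    exact transl_degS hHD hI h₁ h₃ h (embOf hHD hI h₁ h₃) (coverOf hHD hI h₁ h₃ hA)
      (wmOfInput fun V c => (W V c).zeroSK) (d12Of μ) (d34Of μ) V c
      (two_lt_finrank_of_goodCtx hHD hI h₁ h₃ hc hK)
  · -- `hol` — SAN-12 `hol_degS` (every restricted theta form over `degS` is `0`)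
    intro L ι₁ V c hV hc h6 k hk N hN
    exact hol_degS hHD hI h₁ h₃ V c hV (C V c hV hc h6 k hk N hN).toProduct
  · -- `gen12` — SAN-12 `gen12_degS'`
    intro L ι₁ V c
    exact gen12_degS' hHD hI h₁ h₃ h (embOf hHD hI h₁ h₃) (coverOf hHD hI h₁ h₃ hA)
      (fun V c => (W V c).zeroSK) μ V c
  · -- `real34` — SAN-12 `real34_zeroSK`
    intro L ι₁ V c _ _
    exact real34_zeroSK (embOf hHD hI h₁ h₃) (coverOf hHD hI h₁ h₃ hA) W _ h (d12Of μ) (d34Of μ) V c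
  · -- `hyp12` — SAN-12 `hyp12_zeroSK`
    intro L ι₁ V c _ _
    exact hyp12_zeroSK (embOf hHD hI h₁ h₃) (coverOf hHD hI h₁ h₃ hA) W _ h _ _ _ V c
  · -- `hyp34` — SAN-12 `hyp34_zeroSK`
    intro L ι₁ V c _ _
    exact hyp34_zeroSK (embOf hHD hI h₁ h₃) (coverOf hHD hI h₁ h₃ hA) W _ h _ _ _ V c

/-- **The same for E R13** (`Model.perL_picardCM_r13core`, RUN-34 cut A: `transl`/`hStab`/`hLev` discharged in kernel by
glue-1-g4; in v2 the rationality datum is the pin field `S.hRat`, free inside `degS″`), so R13 too closes PerL modulo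
`CdegS` alone. -/
theorem perL_r13core_degS (hHR : BettiUniverse.HodgeRiemann20) (h : Bool) (hA : Arapura2012_Cor_15_4_6)
    (W : ∀ {L : CMField} {ι₁ : L →+* ℂ} (V : HermSpace3 L ι₁) (c : SeesawCtx L), WmInput V c.D)
    (μ : ∀ {L : CMField}, SeesawCtx L → Fin 4 → NumberField.InfinitePlace L → ℤ)
    (hBetti : ∀ {L : CMField} {ι₁ : L →+* ℂ} (V : HermSpace3 L ι₁), EmbBettiSide hHD hI h₁ h₃ V)
    (h31 : (picardCMUniverse hHD hI h₁ h₃).Fact_cmInflation)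
    (C : CdegS hHD hI h₁ h₃ h hA W μ) :
    (picardCMUniverse hHD hI h₁ h₃).PerL := by
  refine perL_picardCM_r13core hHD hI h₁ h₃ hHR h hA (fun V c => (W V c).zeroSK) degS μ hBetti h31
    ?_ C ?_ ?_ ?_ ?_ ?_
  · intro L ι₁ V c hc hK i Γ
    exact hLiu_degS hHD hI h₁ h₃ h (embOf hHD hI h₁ h₃) (coverOf hHD hI h₁ h₃ hA)
      (wmOfInput fun V c => (W V c).zeroSK) (d12Of μ) (d34Of μ) V c hc hK i Γ
  · intro L ι₁ V c hV hc h6 k hk N hN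
    exact hol_degS hHD hI h₁ h₃ V c hV (C V c hV hc h6 k hk N hN).toProduct
  · intro L ι₁ V c
    exact gen12_degS' hHD hI h₁ h₃ h (embOf hHD hI h₁ h₃) (coverOf hHD hI h₁ h₃ hA)
      (fun V c => (W V c).zeroSK) μ V c
  · intro L ι₁ V c _ _
    exact real34_zeroSK (embOf hHD hI h₁ h₃) (coverOf hHD hI h₁ h₃ hA) W _ h (d12Of μ) (d34Of μ) V c
  · intro L ι₁ V c _ _
    exact hyp12_zeroSK (embOf hHD hI h₁ h₃) (coverOf hHD hI h₁ h₃ hA) W _ h _ _ _ V c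
  · intro L ι₁ V c _ _
    exact hyp34_zeroSK (embOf hHD hI h₁ h₃) (coverOf hHD hI h₁ h₃ hA) W _ h _ _ _ V c

/-- **`C` over `degS` is inhabited iff the vacuity residual holds** (SAN-10b `isEmpty_C_fibre_degS` one way,
`False.elim` back). -/
theorem nonempty_CdegS_iff_noGoodSextic (h : Bool) (hA : Arapura2012_Cor_15_4_6)
    (W : ∀ {L : CMField} {ι₁ : L →+* ℂ} (V : HermSpace3 L ι₁) (c : SeesawCtx L), WmInput V c.D)
    (μ : ∀ {L : CMField}, SeesawCtx L → Fin 4 → NumberField.InfinitePlace L → ℤ) :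
    Nonempty (CdegS hHD hI h₁ h₃ h hA W μ) ↔ NoGoodSextic hHD hI h₁ h₃ h hA W μ := by
  constructor
  · rintro ⟨C⟩ _ _ V c hV hc h6
    exact C_over_degS_refutes_guards hHD hI h₁ h₃ V c hV (Q := True) (fun _ => C V c hV hc h6) trivial
  · intro hno
    exact ⟨fun V c hV hc h6 => (hno V c hV hc h6).elim⟩

/-- **E R10 closes from the degenerate data EXACTLY modulo the vacuity residual `NoGoodSextic`.** -/
theorem perL_r10core_of_noGoodSextic (hHR : BettiUniverse.HodgeRiemann20) (h : Bool) (hA : Arapura2012_Cor_15_4_6)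
    (W : ∀ {L : CMField} {ι₁ : L →+* ℂ} (V : HermSpace3 L ι₁) (c : SeesawCtx L), WmInput V c.D)
    (μ : ∀ {L : CMField}, SeesawCtx L → Fin 4 → NumberField.InfinitePlace L → ℤ)
    (hBetti : ∀ {L : CMField} {ι₁ : L →+* ℂ} (V : HermSpace3 L ι₁), EmbBettiSide hHD hI h₁ h₃ V)
    (h31 : (picardCMUniverse hHD hI h₁ h₃).Fact_cmInflation)
    (hno : NoGoodSextic hHD hI h₁ h₃ h hA W μ) :
    (picardCMUniverse hHD hI h₁ h₃).PerL :=
  perL_r10core_degS hHD hI h₁ h₃ hHR h hA W μ hBetti h31 fun V c hV hc h6 => (hno V c hV hc h6).elim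

/-- Conversely, ONE honest anisotropic good sextic context for E's sign recipe certifies that `C` has NO inhabitant
over `degS` — the toy closure is then impossible. -/
theorem isEmpty_CdegS_of_goodSextic (h : Bool) (hA : Arapura2012_Cor_15_4_6)
    (W : ∀ {L : CMField} {ι₁ : L →+* ℂ} (V : HermSpace3 L ι₁) (c : SeesawCtx L), WmInput V c.D)
    (μ : ∀ {L : CMField}, SeesawCtx L → Fin 4 → NumberField.InfinitePlace L → ℤ)
    {L : CMField} {ι₁ : L →+* ℂ} (V : HermSpace3 L ι₁) (c : SeesawCtx L) (hV : IsAnisotropic L V.Hm)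
    (hc : (thetaModelOf hHD hI h₁ h₃ h (embOf hHD hI h₁ h₃) (coverOf hHD hI h₁ h₃ hA)
      (wmOfInput fun V c => (W V c).zeroSK)
      (thetaOf _ (thetaClassInputOf _ (fun V c => thetaSpaceInputOf hHD hI h₁ h₃ degS V c))) (d12Of μ)
      (d34Of μ)).GoodCtx ι₁ c)
    (h6 : Module.finrank ℚ c.K = 6) :
    IsEmpty (CdegS hHD hI h₁ h₃ h hA W μ) :=
  ⟨fun C => (nonempty_CdegS_iff_noGoodSextic hHD hI h₁ h₃ h hA W μ).1 ⟨C⟩ V c hV hc h6⟩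

end Sanity
end Model
end HodgeCM

end
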